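import Literature.NumberTheory.Transcendental.ZeroEstQuotientDerivations
import Literature.NumberTheory.Transcendental.ZeroEstTransversal
import Literature.NumberTheory.Transcendental.ZeroEstHilbert
import Literature.NumberTheory.Transcendental.ZeroEstLocHomogeneous
import Literature.NumberTheory.Transcendental.WustholzMultiplicityDerivations
import Literature.NumberTheory.Transcendental.PhilipponZeroEstimateIndependence
import HarnessLib

/-!
# Zero estimates on commutative algebraic groups, XII: the multiplicity estimate (Prop. 3.8, Steps 1 and 3)

Topic `Literature/NumberTheory/Transcendental`. Twelfth module of the discharge of
`Literature.NumberTheory.Transcendental.philippon1986_std` through D. Roy's exposition of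
Philippon's zero estimate (Nesterenko–Philippon (eds.), LNM 1752, Ch. 11, Prop. 3.8) for an
abstract analytic group model `M : AnalyticGroupModel V N`, with the chart derivations
`d_i = d_{J₀,x_i}` of `A = ℂ[X] ⧸ 𝔊` (`ZeroEstQuotientDerivations.lean`) and the generic
Wüstholz lemma of the tree (`WustholzMultiplicityDerivations.lean`, namespace `MultiplicityLemma`).

* `mk_opPow`, `isHomogeneous_opPow`, `F_opPow_eq_evalQ`: the words `D^μ` in the chart derivations
  of `ℂ[X]` and of `A` correspond, raise the degree by `|μ|`, and `opPowQ = MultiplicityLemma.opPow`.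
* **Step 1** (`opPow_mem_of_mem_loc`): let `𝔭 ⊇ 𝔊` be a relevant homogeneous prime with zero set
  `V`, `X_{J₀} ∉ 𝔭`, `𝔄 ⊆ 𝔭` a homogeneous ideal all of whose members vanish to order `> T` along
  `W` at every point of `V`, and `x_i ∈ W`. Then for every `Q` in the component
  `𝔮 = loc 𝔭 𝔄` and `|μ| ≤ T`, `D^μ [Q] ∈ 𝔭̄ = 𝔭/𝔊`: by homogeneity of `𝔮`
  (`ZeroEstLocHomogeneous.lean`) reduce to a form `Q` with `P₀ Q ∈ 𝔄`, `P₀ ∉ 𝔭` a form; at the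
  points of `V` where `Θ_{J₀} P₀ ≠ 0` the pure jets of `F_Q` vanish (unit `F_{P₀}`), hence the
  mixed words by polarisation (`evalQ_opPowQ_eq_zero_of_forall_pure`); so the form
  `W_μ(Q) · X_{J₀} · P₀` vanishes on `V`, lies in `𝔍(V) = 𝔭`, and `𝔭` is prime.
* **Step 3 and the count** (`choose_mul_hilbC_le`, Roy (95) for the cumulative Hilbert function
  of `ZeroEstHilbert.lean`): given forms `G_1, …, G_s ∈ 𝔭` of degree `≤ c'` with
  `d_i [G_j] ∈ 𝔭̄` (`i ≠ j`), `d_i [G_i] ∉ 𝔭̄` (Step 2, in the sequel) and the conclusion of Step 1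
  for an ideal `𝔮 ⊇ 𝔊`, `binom(T+s, s) · H_𝔭(t) ≤ H_𝔮(t + c'T)`: lifts `F_l ∈ ℂ[X]_{≤t}` of a
  basis modulo `𝔭`, the family `F_l G^κ` (`|κ| ≤ T`, `binom(T+s,s)` multi-indices by
  `GaGm.card_indexSet`) is independent modulo `𝔮` by `MultiplicityLemma.coeff_eq_zero_of_sum_mem` (tree) in `A`.

Everything is PROVED; no named facts.

## References

* Yu. V. Nesterenko, P. Philippon (eds.), *Introduction to Algebraic Independence Theory*,
  LNM 1752, Springer 2001, Ch. 11 (D. Roy), Prop. 3.8, Steps 1 and 3 (pp. 215–218). [NesterenkoPhilippon2001]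
* P. Philippon, *Lemmes de zéros dans les groupes algébriques commutatifs*, Bull. Soc. Math.
  France 114 (1986), 355–383, Prop. 4.7. [Philippon1986]
-/

noncomputable section

open MvPolynomial Set Filter Topology Module
open scoped Pointwise

namespace Literature.NumberTheory.Transcendental

namespace AnalyticGroupModel

variable {V : Type*} [NormedAddCommGroup V] [NormedSpace ℂ V] {N : ℕ} (M : AnalyticGroupModel V N)

attribute [local instance] MvPolynomial.gradedAlgebra

/-! ### Words in the chart derivations, on `ℂ[X]` and on `A` -/

section Words

variable (J₀ : Fin (N + 1)) {s : ℕ} (x : Fin s → V)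

/-- `[D^μ Q] = D^μ [Q]`: the words in the chart derivations of `ℂ[X]` map to the words in the
induced derivations of `A`. [folklore] -/
theorem mk_opPow (μ : Fin s → ℕ) (Q : MvPolynomial (Fin (N + 1)) ℂ) :
    Ideal.Quotient.mk M.relIdeal (MultiplicityLemma.opPow (fun i => M.chartDer J₀ (x i)) μ Q) =
      MultiplicityLemma.opPow (fun i => M.quotDer J₀ (x i)) μ (Ideal.Quotient.mk M.relIdeal Q) := by
  induction s generalizing Q with
  | zero => rfl
  | succ s ih =>
    have h1 : MultiplicityLemma.opPow (fun i => M.chartDer J₀ (x i)) μ Q =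
        (M.chartDer J₀ (x 0))^[μ 0] (MultiplicityLemma.opPow (fun i => M.chartDer J₀ (x i.succ)) (Fin.tail μ) Q) := rfl
    have h2 : MultiplicityLemma.opPow (fun i => M.quotDer J₀ (x i)) μ (Ideal.Quotient.mk M.relIdeal Q) =
        (M.quotDer J₀ (x 0))^[μ 0]
          (MultiplicityLemma.opPow (fun i => M.quotDer J₀ (x i.succ)) (Fin.tail μ) (Ideal.Quotient.mk M.relIdeal Q)) := rfl
    rw [h1, h2, ← ih (fun i => x i.succ) (Fin.tail μ) Q, quotDer_iterate_mk]

/-- `opPowQ = MultiplicityLemma.opPow` for the induced derivations. [folklore] -/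
theorem opPowQ_eq_opPow (μ : Fin s → ℕ) (q : M.Quot) :
    M.opPowQ J₀ x μ q = MultiplicityLemma.opPow (fun i => M.quotDer J₀ (x i)) μ q := by
  induction s generalizing q with
  | zero => rw [opPowQ_zero]; rfl
  | succ s ih => rw [opPowQ_succ, MultiplicityLemma.opPow_succ, ih]; rfl

/-- **`D^μ` raises the degree by `|μ|`.** [folklore] -/
theorem isHomogeneous_opPow (μ : Fin s → ℕ) {Q : MvPolynomial (Fin (N + 1)) ℂ} {D : ℕ} (hQ : Q.IsHomogeneous D) :
    (MultiplicityLemma.opPow (fun i => M.chartDer J₀ (x i)) μ Q).IsHomogeneous (D + MultiplicityLemma.order μ) := by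
  induction s generalizing Q D with
  | zero => simpa [MultiplicityLemma.order] using hQ
  | succ s ih =>
    rw [MultiplicityLemma.opPow_succ]
    have h := ih (fun i => x i.succ) (Fin.tail μ) hQ
    have h2 := M.isHomogeneous_iterate_chartDer J₀ (x 0) (μ 0) h
    have hord : MultiplicityLemma.order μ = μ 0 + MultiplicityLemma.order (Fin.tail μ) := by
      simp only [MultiplicityLemma.order, Fin.sum_univ_succ]; rfl
    rw [hord, show D + (μ 0 + MultiplicityLemma.order (Fin.tail μ)) = D + MultiplicityLemma.order (Fin.tail μ) + μ 0 by ring]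
    exact h2

/-- `F_{D^μ Q}(a) = evalQ a (D^μ [Q])`. [folklore] -/
theorem F_opPow_eq_evalQ (μ : Fin s → ℕ) (Q : MvPolynomial (Fin (N + 1)) ℂ) (a : V) :
    M.F (MultiplicityLemma.opPow (fun i => M.chartDer J₀ (x i)) μ Q) a =
      M.evalQ a (MultiplicityLemma.opPow (fun i => M.quotDer J₀ (x i)) μ (Ideal.Quotient.mk M.relIdeal Q)) := by
  rw [← mk_opPow, evalQ_mk]

end Words

/-! ### Step 1: the words of the members of `𝔮 = loc 𝔭 𝔄` lie in `𝔭` -/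

section Step1

variable {W : Submodule ℂ V} {𝔭 𝔄 : Ideal (MvPolynomial (Fin (N + 1)) ℂ)}

/-- A unit factor does not change the order of vanishing. [folklore] -/
theorem VanishesToOrder.of_F_mul {P Q : MvPolynomial (Fin (N + 1)) ℂ} {a : V} {T : ℕ}
    (h : VanishesToOrder W (M.F (P * Q)) a T) (hP : M.F P a ≠ 0) : VanishesToOrder W (M.F Q) a T := by
  intro y hy
  have h1 := h y hy
  have heq : (fun t : ℂ => M.F (P * Q) (a + t • y)) = fun t => M.F P (a + t • y) * M.F Q (a + t • y) := by
    funext t; simp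
  rw [heq] at h1
  exact (forall_iteratedDeriv_mul_eq_zero_iff_of_ne_zero (M.analyticAt_F_line Q a y 0)
    (M.analyticAt_F_line P a y 0) (by simpa using hP) T).mp h1

/-- **Step 1 for a form.** [cite: NesterenkoPhilippon2001, Ch. 11 Prop. 3.8 (Step 1)] -/
theorem opPow_mem_of_isHomogeneous [h𝔭 : 𝔭.IsPrime] (hhom : 𝔭.IsHomogeneous (homogeneousSubmodule (Fin (N + 1)) ℂ))
    (h𝔊 : M.relIdeal ≤ 𝔭) (hrel : M.IsRelevant 𝔭) {J₀ : Fin (N + 1)} (hJ₀ : (X J₀ : MvPolynomial (Fin (N + 1)) ℂ) ∉ 𝔭)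
    {T : ℕ} (hvan : ∀ Q ∈ 𝔄, ∀ a ∈ M.zeroSet ((𝔭 : Ideal _) : Set (MvPolynomial (Fin (N + 1)) ℂ)),
      VanishesToOrder W (M.F Q) a (T + 1))
    {s : ℕ} {x : Fin s → V} (hx : ∀ i, x i ∈ W)
    {Q P₀ : MvPolynomial (Fin (N + 1)) ℂ} {D D₀ : ℕ} (hQ : Q.IsHomogeneous D) (hP₀ : P₀.IsHomogeneous D₀)
    (hP₀𝔭 : P₀ ∉ 𝔭) (hP₀Q : P₀ * Q ∈ 𝔄) {μ : Fin s → ℕ} (hμ : MultiplicityLemma.order μ ≤ T) :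
    MultiplicityLemma.opPow (fun i => M.chartDer J₀ (x i)) μ Q ∈ 𝔭 := by
  set Wμ := MultiplicityLemma.opPow (fun i => M.chartDer J₀ (x i)) μ Q with hWμ
  have hWμhom : Wμ.IsHomogeneous (D + MultiplicityLemma.order μ) := M.isHomogeneous_opPow J₀ x μ hQ
  -- `F_{Wμ}` vanishes at the points of `V` where `Θ_{J₀} P₀ ≠ 0`
  have hgood : ∀ a ∈ M.zeroSet ((𝔭 : Ideal _) : Set (MvPolynomial (Fin (N + 1)) ℂ)),
      M.Θ J₀ a ≠ 0 → M.F P₀ a ≠ 0 → M.F Wμ a = 0 := by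
    intro a ha hΘ hPa
    have hvQ : VanishesToOrder W (M.F Q) a (T + 1) := VanishesToOrder.of_F_mul M (hvan _ hP₀Q a ha) hPa
    rw [M.vanishesToOrder_iff_quotDer hΘ hQ W (T + 1)] at hvQ
    rw [hWμ, F_opPow_eq_evalQ, ← opPowQ_eq_opPow]
    refine M.evalQ_opPowQ_eq_zero_of_forall_pure hΘ a W (T := T) (fun y hy k hk => hvQ y hy k (by omega))
      x hx μ ?_
    exact hμ
  -- hence `Wμ · X_{J₀} · P₀ ∈ 𝔍(V) = 𝔭`
  have hprod : Wμ * X J₀ * P₀ ∈ 𝔭 := by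
    rw [← M.vanishing_zeroSet_eq_of_isPrime hhom h𝔊 hrel,
      M.mem_vanishing_iff_of_isHomogeneous ((hWμhom.mul (isHomogeneous_X ℂ J₀)).mul hP₀)]
    intro a ha
    rw [F_mul, F_mul, F_X]
    by_cases hΘ : M.Θ J₀ a = 0
    · rw [hΘ, mul_zero, zero_mul]
    by_cases hPa : M.F P₀ a = 0
    · rw [hPa, mul_zero]
    rw [hgood a ha hΘ hPa, zero_mul, zero_mul]
  rcases h𝔭.mem_or_mem hprod with h1 | h1
  · rcases h𝔭.mem_or_mem h1 with h2 | h2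
    · exact h2
    · exact absurd h2 hJ₀
  · exact absurd h1 hP₀𝔭

/-- **Step 1** (Roy, Prop. 3.8): for `Q ∈ loc 𝔭 𝔄` and `|μ| ≤ T`, the word `D^μ Q` lies in `𝔭`
(equivalently `D^μ [Q] ∈ 𝔭̄` in `A`). [cite: NesterenkoPhilippon2001, Ch. 11 Prop. 3.8 (Step 1)] -/
theorem opPow_mem_of_mem_loc (h𝔭 : 𝔭.IsPrime) (hhom : 𝔭.IsHomogeneous (homogeneousSubmodule (Fin (N + 1)) ℂ))
    (h𝔊 : M.relIdeal ≤ 𝔭) (hrel : M.IsRelevant 𝔭) (h𝔄 : 𝔄.IsHomogeneous (homogeneousSubmodule (Fin (N + 1)) ℂ))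
    {J₀ : Fin (N + 1)} (hJ₀ : (X J₀ : MvPolynomial (Fin (N + 1)) ℂ) ∉ 𝔭)
    {T : ℕ} (hvan : ∀ Q ∈ 𝔄, ∀ a ∈ M.zeroSet ((𝔭 : Ideal _) : Set (MvPolynomial (Fin (N + 1)) ℂ)),
      VanishesToOrder W (M.F Q) a (T + 1))
    {s : ℕ} {x : Fin s → V} (hx : ∀ i, x i ∈ W) {Q : MvPolynomial (Fin (N + 1)) ℂ}
    (hQ : Q ∈ GaGm.loc 𝔭 h𝔭 𝔄) {μ : Fin s → ℕ} (hμ : MultiplicityLemma.order μ ≤ T) :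
    MultiplicityLemma.opPow (fun i => M.chartDer J₀ (x i)) μ Q ∈ 𝔭 := by
  classical
  haveI := h𝔭
  -- reduce to the homogeneous components of `Q`, which lie in `loc 𝔭 𝔄`
  rw [← sum_homogeneousComponent Q, MultiplicityLemma.opPow_sum]
  refine Submodule.sum_mem _ fun e _ => ?_
  have hQe : homogeneousComponent e Q ∈ GaGm.loc 𝔭 h𝔭 𝔄 := ZeroEst.homogeneousComponent_mem_loc h𝔭 hhom h𝔄 hQ e
  obtain ⟨P₀, hP₀𝔭, hP₀Q⟩ := hQe
  -- a homogeneous component of `P₀` outside `𝔭` still multiplies `Q_e` into `𝔄`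
  obtain ⟨j, hj⟩ : ∃ j, homogeneousComponent j P₀ ∉ 𝔭 := by
    by_contra hall
    push Not at hall
    apply hP₀𝔭
    rw [← sum_homogeneousComponent P₀]
    exact Submodule.sum_mem _ fun j _ => hall j
  have hjQ : homogeneousComponent j P₀ * homogeneousComponent e Q ∈ 𝔄 := by
    have h := h𝔄 (j + e) hP₀Q
    rw [← DirectSum.Decomposition.decompose'_eq, decomposition.decompose'_apply] at h
    have heq : homogeneousComponent (j + e) (P₀ * homogeneousComponent e Q) =
        homogeneousComponent j P₀ * homogeneousComponent e Q := by
      conv_lhs => rw [← sum_homogeneousComponent P₀, Finset.sum_mul, map_sum]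
      rw [Finset.sum_eq_single j]
      · rw [homogeneousComponent_of_mem ((homogeneousComponent_isHomogeneous j P₀).mul
          (homogeneousComponent_isHomogeneous e Q)), if_pos rfl]
      · intro b _ hb
        rw [homogeneousComponent_of_mem ((homogeneousComponent_isHomogeneous b P₀).mul
          (homogeneousComponent_isHomogeneous e Q)), if_neg]
        omega
      · intro hjr
        rw [Finset.mem_range, not_lt] at hjr
        rw [homogeneousComponent_eq_zero j P₀ (by omega), zero_mul, map_zero]
    rwa [heq] at h
  exact M.opPow_mem_of_isHomogeneous hhom h𝔊 hrel hJ₀ hvan hx (homogeneousComponent_isHomogeneous e Q)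
    (homogeneousComponent_isHomogeneous j P₀) hj hjQ hμ

end Step1

/-! ### Step 3 and the count -/

section Count

variable {𝔭 𝔮 : Ideal (MvPolynomial (Fin (N + 1)) ℂ)} {s : ℕ}

/-- The power products `G^κ` in `ℂ[X]`. [folklore] -/
theorem mk_gpow (G : Fin s → MvPolynomial (Fin (N + 1)) ℂ) (κ : Fin s → ℕ) :
    Ideal.Quotient.mk M.relIdeal (MultiplicityLemma.gpow G κ) = MultiplicityLemma.gpow (fun i => Ideal.Quotient.mk M.relIdeal (G i)) κ := by
  simp [MultiplicityLemma.gpow, map_prod]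

/-- Power products of polynomials of degree `≤ c'` have degree `≤ c'|κ|`. [folklore] -/
theorem gpow_mem_Fil {c' : ℕ} {G : Fin s → MvPolynomial (Fin (N + 1)) ℂ} (hG : ∀ i, G i ∈ ZeroEst.Fil (N := N) c')
    (κ : Fin s → ℕ) : MultiplicityLemma.gpow G κ ∈ ZeroEst.Fil (N := N) (c' * MultiplicityLemma.order κ) := by
  classical
  unfold MultiplicityLemma.gpow MultiplicityLemma.order
  have hpow : ∀ i (k : ℕ), G i ^ k ∈ ZeroEst.Fil (N := N) (c' * k) := by
    intro i k
    induction k with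
    | zero => simpa using ZeroEst.one_mem_Fil (N := N) 0
    | succ k ih => rw [pow_succ, Nat.mul_succ]; exact ZeroEst.mul_mem_Fil ih (hG i)
  have key : ∀ t : Finset (Fin s), ∏ i ∈ t, G i ^ κ i ∈ ZeroEst.Fil (N := N) (c' * ∑ i ∈ t, κ i) := by
    intro t
    induction t using Finset.induction_on with
    | empty => simpa using ZeroEst.one_mem_Fil (N := N) 0
    | insert a t ha ih =>
      rw [Finset.prod_insert ha, Finset.sum_insert ha, Nat.mul_add]
      exact ZeroEst.mul_mem_Fil (hpow a _) ih
  exact key Finset.univ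

/-- **The count** (Roy (95), cumulative Hilbert functions): `binom(T+s, s) · H_𝔭(t) ≤ H_𝔮(t + c'T)`.
Data: a prime `𝔭 ⊇ 𝔊`, an ideal `𝔮 ⊇ 𝔊`, commuting derivations `d_i` of `A = ℂ[X] ⧸ 𝔊` sending
the classes of the members of `𝔮` into `𝔭̄` by the words of order `≤ T` (Step 1), and
`G_1, …, G_s ∈ 𝔭 ∩ ℂ[X]_{≤c'}` with `d_i[G_j] ∈ 𝔭̄` (`i ≠ j`), `d_i[G_i] ∉ 𝔭̄` (Step 2).
[cite: NesterenkoPhilippon2001, Ch. 11 Prop. 3.8 (95)] -/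
theorem choose_mul_hilbC_le (h𝔭 : 𝔭.IsPrime) (h𝔊𝔭 : M.relIdeal ≤ 𝔭)
    {d : Fin s → Derivation ℂ M.Quot M.Quot} (hcomm : ∀ i j (a : M.Quot), d i (d j a) = d j (d i a))
    {G : Fin s → MvPolynomial (Fin (N + 1)) ℂ} (hG : ∀ i, G i ∈ 𝔭) {c' : ℕ} (hGdeg : ∀ i, G i ∈ ZeroEst.Fil (N := N) c')
    (hoff : ∀ i j, i ≠ j → d i (Ideal.Quotient.mk M.relIdeal (G j)) ∈ 𝔭.map (Ideal.Quotient.mk M.relIdeal))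
    (hdiag : ∀ i, d i (Ideal.Quotient.mk M.relIdeal (G i)) ∉ 𝔭.map (Ideal.Quotient.mk M.relIdeal))
    {T : ℕ} (H𝔮 : ∀ Q ∈ 𝔮, ∀ μ : Fin s → ℕ, MultiplicityLemma.order μ ≤ T →
      MultiplicityLemma.opPow d μ (Ideal.Quotient.mk M.relIdeal Q) ∈ 𝔭.map (Ideal.Quotient.mk M.relIdeal)) (t : ℕ) :
    (T + s).choose s * ZeroEst.hilbC (𝔭.restrictScalars ℂ) t ≤
      ZeroEst.hilbC (N := N) (𝔮.restrictScalars ℂ) (t + c' * T) := by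
  classical
  set 𝔭b : Ideal M.Quot := 𝔭.map (Ideal.Quotient.mk M.relIdeal) with h𝔭b
  set 𝔮b : Ideal M.Quot := 𝔮.map (Ideal.Quotient.mk M.relIdeal) with h𝔮b
  have hker : RingHom.ker (Ideal.Quotient.mk M.relIdeal) = M.relIdeal := Ideal.mk_ker
  haveI h𝔭bp : 𝔭b.IsPrime := by
    haveI := h𝔭
    exact Ideal.map_isPrime_of_surjective Ideal.Quotient.mk_surjective (by rw [hker]; exact h𝔊𝔭)
  have hmem𝔭 : ∀ {y : MvPolynomial (Fin (N + 1)) ℂ}, (Ideal.Quotient.mk M.relIdeal) y ∈ 𝔭b ↔ y ∈ 𝔭 := by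
    intro y
    rw [h𝔭b, ← Ideal.mem_comap, Ideal.comap_map_of_surjective (Ideal.Quotient.mk M.relIdeal) Ideal.Quotient.mk_surjective,
      ← RingHom.ker_eq_comap_bot, hker, sup_eq_left.mpr h𝔊𝔭]
  -- a basis of `Fil t` modulo `Fil t ∩ 𝔭`
  set Vt : Submodule ℂ (MvPolynomial (Fin (N + 1)) ℂ) := ZeroEst.Fil (N := N) t with hVt
  set U : Submodule ℂ ↥Vt := (Submodule.restrictScalars ℂ 𝔭).comap Vt.subtype with hU
  set b := Module.finBasis ℂ (↥Vt ⧸ U) with hb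
  set Nn := finrank ℂ (↥Vt ⧸ U) with hNn
  have hNeq : Nn = ZeroEst.hilbC (N := N) (Submodule.restrictScalars ℂ 𝔭) t := by
    have h1 := Submodule.finrank_quotient_add_finrank U
    have hmap : U.map Vt.subtype = Vt ⊓ Submodule.restrictScalars ℂ 𝔭 := by
      ext y
      simp only [Submodule.mem_map, Submodule.mem_comap, Submodule.coe_subtype, hU,
        Submodule.mem_inf, Submodule.restrictScalars_mem]
      constructor
      · rintro ⟨z, hz, rfl⟩; exact ⟨z.2, hz⟩
      · rintro ⟨hy, hy'⟩; exact ⟨⟨y, hy⟩, hy', rfl⟩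
    have h2 : finrank ℂ U = finrank ℂ ↥(Vt ⊓ Submodule.restrictScalars ℂ 𝔭) := by
      rw [← Submodule.finrank_map_subtype_eq Vt U, hmap]
    rw [ZeroEst.hilbC, ← h1, h2, Nat.add_sub_cancel]
  -- lifts of the basis vectors
  choose F hF using fun l => Submodule.Quotient.mk_surjective U (b l)
  have hFind : ∀ e : Fin Nn → ℂ, (∑ l, e l • (F l : MvPolynomial (Fin (N + 1)) ℂ)) ∈ 𝔭 → ∀ l, e l = 0 := by
    intro e he
    have hmem : (∑ l, e l • F l : ↥Vt) ∈ U := by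
      simp only [hU, Submodule.mem_comap, Submodule.coe_subtype, Submodule.restrictScalars_mem,
        Submodule.coe_sum, Submodule.coe_smul]
      exact he
    have h0 : (∑ l, e l • b l : ↥Vt ⧸ U) = 0 := by
      have h := (Submodule.Quotient.mk_eq_zero U).mpr hmem
      have h' : (Submodule.Quotient.mk (∑ l, e l • F l) : ↥Vt ⧸ U) = ∑ l, e l • b l := by
        rw [← Submodule.mkQ_apply, map_sum]
        exact Finset.sum_congr rfl fun l _ => by rw [map_smul, Submodule.mkQ_apply, hF]
      rw [← h']; exact h
    exact fun l => Fintype.linearIndependent_iff.mp b.linearIndependent e h0 l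
  -- independence modulo `𝔭̄` of the classes
  have hFbar : ∀ e : Fin Nn → ℂ, (∑ l, e l • (Ideal.Quotient.mk M.relIdeal) (F l : MvPolynomial (Fin (N + 1)) ℂ)) ∈ 𝔭b → ∀ l, e l = 0 := by
    intro e he
    refine hFind e (hmem𝔭.mp ?_)
    have : (Ideal.Quotient.mk M.relIdeal) (∑ l, e l • (F l : MvPolynomial (Fin (N + 1)) ℂ)) =
        ∑ l, e l • (Ideal.Quotient.mk M.relIdeal) (F l : MvPolynomial (Fin (N + 1)) ℂ) := by
      rw [map_sum]
      exact Finset.sum_congr rfl fun l _ => by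
        rw [Algebra.smul_def, map_mul, Ideal.Quotient.mk_algebraMap, ← Algebra.smul_def]
    rw [this]; exact he
  -- Step 3 in `A`
  set g : Fin s → M.Quot := fun i => (Ideal.Quotient.mk M.relIdeal) (G i) with hg
  have hg𝔭 : ∀ i, g i ∈ 𝔭b := fun i => Ideal.mem_map_of_mem (Ideal.Quotient.mk M.relIdeal) (hG i)
  have H𝔮b : ∀ f ∈ 𝔮b, ∀ μ : Fin s → ℕ, MultiplicityLemma.order μ ≤ T → MultiplicityLemma.opPow d μ f ∈ 𝔭b := by
    intro f hf μ hμ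
    obtain ⟨Q, hQ, rfl⟩ := (Ideal.mem_map_iff_of_surjective (Ideal.Quotient.mk M.relIdeal) Ideal.Quotient.mk_surjective).mp hf
    exact H𝔮 Q hQ μ hμ
  -- the family `Φ (l, κ) = F_l G^κ`, `κ ∈ K = indexSet s T`
  set K := GaGm.indexSet s T with hK
  set Φ : Fin Nn × ↥K → MvPolynomial (Fin (N + 1)) ℂ := fun p =>
    (F p.1 : MvPolynomial (Fin (N + 1)) ℂ) * MultiplicityLemma.gpow G p.2.1 with hΦ
  have horder : ∀ κ ∈ K, MultiplicityLemma.order κ ≤ T := fun κ hκ => GaGm.order_le_of_mem_indexSet hκ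
  have hΦmem : ∀ p, Φ p ∈ ZeroEst.Fil (N := N) (t + c' * T) := fun p =>
    ZeroEst.Fil_mono (by have := horder p.2.1 p.2.2; nlinarith) (ZeroEst.mul_mem_Fil (F p.1).2 (gpow_mem_Fil hGdeg p.2.1))
  have hcoef : ∀ e : Fin Nn × ↥K → ℂ, (∑ p, e p • Φ p) ∈ 𝔮 → ∀ p, e p = 0 := by
    intro e he p
    -- push the relation to `A`
    have he' : (∑ l, ∑ κ ∈ K, (fun l κ => if h : κ ∈ K then e (l, ⟨κ, h⟩) else 0) l κ •
        ((Ideal.Quotient.mk M.relIdeal) (F l : MvPolynomial (Fin (N + 1)) ℂ) * MultiplicityLemma.gpow g κ)) ∈ 𝔮b := by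
      have e1 : (∑ l, ∑ κ ∈ K, (fun l κ => if h : κ ∈ K then e (l, ⟨κ, h⟩) else 0) l κ •
          ((Ideal.Quotient.mk M.relIdeal) (F l : MvPolynomial (Fin (N + 1)) ℂ) * MultiplicityLemma.gpow g κ)) = (Ideal.Quotient.mk M.relIdeal) (∑ p, e p • Φ p) := by
        rw [map_sum, Fintype.sum_prod_type]
        refine Finset.sum_congr rfl fun l _ => ?_
        rw [← Finset.sum_coe_sort K]
        refine Finset.sum_congr rfl fun κ _ => ?_
        dsimp only
        rw [dif_pos κ.2]
        change _ = (Ideal.Quotient.mk M.relIdeal) (e (l, κ) • ((F l : MvPolynomial (Fin (N + 1)) ℂ) * MultiplicityLemma.gpow G κ))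
        rw [Algebra.smul_def, map_mul, map_mul, Ideal.Quotient.mk_algebraMap, mk_gpow, ← Algebra.smul_def]
      rw [e1]
      exact Ideal.mem_map_of_mem (Ideal.Quotient.mk M.relIdeal) he
    have key := MultiplicityLemma.coeff_eq_zero_of_sum_mem hcomm h𝔭bp hg𝔭 hoff hdiag H𝔮b K horder hFbar
      (fun l κ => if h : κ ∈ K then e (l, ⟨κ, h⟩) else 0) he' p.1 p.2.1 p.2.2
    simpa using key
  have hli : LinearIndependent ℂ Φ :=
    Fintype.linearIndependent_iff.mpr fun e he => hcoef e (by rw [he]; exact Ideal.zero_mem _)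
  set S := Submodule.span ℂ (Set.range Φ) with hS
  set Qm := ZeroEst.Fil (N := N) (t + c' * T) ⊓ Submodule.restrictScalars ℂ 𝔮 with hQm
  have hdisj : S ⊓ Qm = ⊥ := by
    rw [Submodule.eq_bot_iff]
    rintro y ⟨hy, hy'⟩
    obtain ⟨e, rfl⟩ := (Submodule.mem_span_range_iff_exists_fun ℂ).mp hy
    have h0 := hcoef e hy'.2
    simp [h0]
  have hle : S ⊔ Qm ≤ ZeroEst.Fil (N := N) (t + c' * T) :=
    sup_le (Submodule.span_le.mpr (by rintro _ ⟨p, rfl⟩; exact hΦmem p)) inf_le_left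
  have hfinS : finrank ℂ S = Nn * K.card := by
    rw [hS, finrank_span_eq_card hli, Fintype.card_prod, Fintype.card_fin, Fintype.card_coe]
  haveI : FiniteDimensional ℂ S := FiniteDimensional.span_of_finite ℂ (Set.finite_range Φ)
  haveI : FiniteDimensional ℂ Qm := Submodule.finiteDimensional_of_le (inf_le_left :
    Qm ≤ ZeroEst.Fil (N := N) (t + c' * T))
  have hsum := Submodule.finrank_sup_add_finrank_inf_eq S Qm
  rw [hdisj, finrank_bot, add_zero] at hsum
  have hmono := Submodule.finrank_mono hle
  rw [GaGm.card_indexSet] at hfinS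
  set P := (T + s).choose s * Nn with hP
  have hfinS' : finrank ℂ S = P := by rw [hfinS, hP, mul_comm]
  have hQle : finrank ℂ Qm ≤ finrank ℂ ↥(ZeroEst.Fil (N := N) (t + c' * T)) := Submodule.finrank_mono inf_le_left
  rw [← hNeq]
  show P ≤ finrank ℂ ↥(ZeroEst.Fil (N := N) (t + c' * T)) - finrank ℂ Qm
  omega

end Count

end AnalyticGroupModel

end Literature.NumberTheory.Transcendental
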